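import Summits.AtomisticToContinuum.Crystallization.Theorems.OverbindingBudgetAffineTwinCutA

/-!
# NODE g77 «TwinCut» (lens-4 g77) — part 2 of 3 (sequel of `…OverbindingBudgetAffineTwinCutA`)

Split for the 400-line cap by the landing lane (hand-2 g36); the module docstring of part 1 (`…OverbindingBudgetAffineTwinCutA`) describes the whole node.  Same namespace; all FQNs unchanged.
0 sorry; standard axioms.
-/


namespace Summit.AtomisticToContinuum.Crystallization.Theorems.OverbindingBudgetAffineTwinCut

open scoped BigOperators Classical
open Literature.MathematicalPhysics.StatisticalMechanics
open Literature.Geometry.DiscreteGeometry (IsChargeFree nearestDist nearestDist_nonneg nearestDist_le_dist fccTwoShellPattern hcpTwoShellPattern)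
open Summit.AtomisticToContinuum.Crystallization.Theorems.OverbindingBudgetMisfitRegistration (Framed Reg DeepReg)
open Summit.AtomisticToContinuum.Crystallization.Theorems.OverbindingBudgetMisfitWindowStatements (InWindow offCount)
open Summit.AtomisticToContinuum.Crystallization.Theorems.OverbindingBudgetBalancedCensusStatements
open Summit.AtomisticToContinuum.Crystallization.Theorems.OverbindingBudgetHarmonicNormalForm (convexComb_core)
open Summit.AtomisticToContinuum.Crystallization.Theorems.OverbindingBudgetAffineLadder
open Summit.AtomisticToContinuum.Crystallization.Theorems.OverbindingBudgetAffineMesoCut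
open Summit.AtomisticToContinuum.Crystallization.Theorems.OverbindingBudgetAffinePhaseCut
open Summit.AtomisticToContinuum.Crystallization.Theorems.OverbindingBudgetAffineCushionCut

variable {N : ℕ}

local notation "E3" => EuclideanSpace ℝ (Fin 3)

/-! ## §3  CENSUS ALGEBRA over an arbitrary count and rebate (PROVED once): monotonicity and the glued convex combination -/

/-- The census inequality of the line for an ARBITRARY priced count `cnt` and rebated count `reb` on the window `[σ₁, σ₂]`: `c > 0` per counted site
against `C·(reb + #off + N^{2/3} + gains)`.  Every `Balanced…GapW` of g75/g76 and of this file is `CensusW` of its two counts, by `Iff.rfl` (below). -/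
def CensusW (cnt reb : ∀ {N : ℕ}, (Fin N → E3) → ℕ) (σ₁ σ₂ : ℝ) : Prop :=
  ∃ c C : ℝ, 0 < c ∧ ∀ (N : ℕ) (y : Fin N → E3), Function.Injective y →
    ∃ u : E3, ‖u‖ = 1 ∧
      (N : ℝ) * (⨅ Q : PeriodicConfiguration 3, Q.energyPerParticle lennardJones) + c * (cnt y : ℝ)
        - C * (reb y : ℝ) - C * (offCount σ₁ σ₂ y : ℝ) - C * (N : ℝ) ^ (2 / 3 : ℝ) - C * (dilGain y + shGain u y)
        ≤ interactionEnergy lennardJones y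

/-- **Census monotonicity**: pricing a count with a rebate prices every pointwise smaller count with every pointwise larger rebate (g75's
`balancedW_mono_core` BY NAME). [this file] -/
theorem censusW_mono {A R D X : ∀ {N : ℕ}, (Fin N → E3) → ℕ} {σ₁ σ₂ : ℝ} (hRA : ∀ {N : ℕ} (y : Fin N → E3), R y ≤ A y)
    (hDX : ∀ {N : ℕ} (y : Fin N → E3), D y ≤ X y) (h : CensusW A D σ₁ σ₂) : CensusW R X σ₁ σ₂ := by
  obtain ⟨c, C, hc, h⟩ := h
  refine ⟨c, max C 0, hc, fun N y hy => ?_⟩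
  obtain ⟨u, hu, e⟩ := h N y hy
  refine ⟨u, hu, ?_⟩
  have hR : (R y : ℝ) ≤ A y := by exact_mod_cast hRA y
  have hX : (D y : ℝ) ≤ X y := by exact_mod_cast hDX y
  exact balancedW_mono_core e hc.le hR hX (Nat.cast_nonneg _) (Nat.cast_nonneg _) (Real.rpow_nonneg (Nat.cast_nonneg _) _)
    (add_nonneg (dilGain_nonneg y) (shGain_nonneg _ y))

/-- The rate of the glued convex combination of two census inequalities with rates `c₁, c₂` and first constant `C₁`. -/
noncomputable def glueRate (c₁ C₁ c₂ : ℝ) : ℝ :=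
  min (c₂ / (4 * (max C₁ 0 + c₂ + 1)) * c₁) (c₂ / 4)

/-- `glueRate_pos` (docstring added by the landing lane; see the module docstring). [formal bookkeeping] -/
theorem glueRate_pos {c₁ C₁ c₂ : ℝ} (hc₁ : 0 < c₁) (hc₂ : 0 < c₂) : 0 < glueRate c₁ C₁ c₂ := by
  have hP : 0 ≤ max C₁ 0 := le_max_right _ _
  have hK : 0 < max C₁ 0 + c₂ + 1 := by linarith
  unfold glueRate
  exact lt_min (mul_pos (by positivity) hc₁) (by positivity)

/-- **The glued convex combination, real-arithmetic core** (g41's `convexComb_core` BY NAME with its side conditions discharged): inequality 1 prices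
`A` and may rebate `D₁ ≤ D + B`, inequality 2 prices `B` with rebate `D`; together they price every `R ≤ A + B` with rebate `D`. [this file] -/
theorem gluedW_core {e E c₁ C₁ c₂ C₂ A B R D₁ D O S G₁ G₂ G : ℝ}
    (h₁ : e + c₁ * A - C₁ * D₁ - C₁ * O - C₁ * S - C₁ * G₁ ≤ E) (h₂ : e + c₂ * B - C₂ * D - C₂ * O - C₂ * S - C₂ * G₂ ≤ E)
    (hR : R ≤ A + B) (hD₁ : D₁ ≤ D + B) (hA : 0 ≤ A) (hB : 0 ≤ B) (hD : 0 ≤ D) (hD₁0 : 0 ≤ D₁) (hO : 0 ≤ O) (hS : 0 ≤ S)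
    (hG₁ : 0 ≤ G₁) (hG₂ : 0 ≤ G₂) (hG₁G : G₁ ≤ G) (hG₂G : G₂ ≤ G) (hc₁ : 0 < c₁) (hc₂ : 0 < c₂) :
    e + glueRate c₁ C₁ c₂ * R - (max C₁ 0 + max C₂ 0) * D - (max C₁ 0 + max C₂ 0) * O - (max C₁ 0 + max C₂ 0) * S
      - (max C₁ 0 + max C₂ 0) * G ≤ E := by
  have hP₁0 : 0 ≤ max C₁ 0 := le_max_right _ _
  have hK : 0 < max C₁ 0 + c₂ + 1 := by linarith
  set t : ℝ := c₂ / (4 * (max C₁ 0 + c₂ + 1)) with ht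
  have ht0 : 0 < t := by rw [ht]; positivity
  have ht4 : t ≤ 1 / 4 := by
    rw [ht, div_le_iff₀ (by positivity)]
    nlinarith
  have htP : t * max C₁ 0 ≤ c₂ / 4 := by
    rw [ht, div_mul_eq_mul_div, div_le_iff₀ (by positivity)]
    nlinarith [mul_nonneg hc₂.le hP₁0, mul_nonneg hc₂.le hc₂.le]
  have hm : glueRate c₁ C₁ c₂ = min (t * c₁) (c₂ / 4) := by simp only [glueRate, ht]
  rw [hm]
  exact convexComb_core h₁ h₂ hR hD₁ hA hB hD hD₁0 hO hS hG₁ hG₂ hG₁G hG₂G hc₂ ht0 ht4 htP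
    (le_min (mul_nonneg ht0.le hc₁.le) (by positivity)) (min_le_left _ _) (min_le_right _ _)

/-- **Census glue**: pricing `A` (rebate `D₁ ≤ D + B`) and pricing `B` (rebate `D`) prices every count `R ≤ A + B` with rebate `D` — rate `glueRate`,
constant `max C₁ 0 + max C₂ 0`, shear direction the one of larger gain. [this file] -/
theorem censusW_glue {A B R D₁ D : ∀ {N : ℕ}, (Fin N → E3) → ℕ} {σ₁ σ₂ : ℝ} (hR : ∀ {N : ℕ} (y : Fin N → E3), R y ≤ A y + B y)
    (hD₁ : ∀ {N : ℕ} (y : Fin N → E3), D₁ y ≤ D y + B y) (hA : CensusW A D₁ σ₁ σ₂) (hB : CensusW B D σ₁ σ₂) : CensusW R D σ₁ σ₂ := by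
  obtain ⟨c₁, C₁, hc₁, h₁⟩ := hA
  obtain ⟨c₂, C₂, hc₂, h₂⟩ := hB
  refine ⟨glueRate c₁ C₁ c₂, max C₁ 0 + max C₂ 0, glueRate_pos hc₁ hc₂, fun N y hy => ?_⟩
  obtain ⟨u₁, hu₁, H₁⟩ := h₁ N y hy
  obtain ⟨u₂, hu₂, H₂⟩ := h₂ N y hy
  have hRc : (R y : ℝ) ≤ A y + B y := by exact_mod_cast hR y
  have hDc : (D₁ y : ℝ) ≤ D y + B y := by exact_mod_cast hD₁ y
  have n1 : (0 : ℝ) ≤ A y := Nat.cast_nonneg _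
  have n2 : (0 : ℝ) ≤ B y := Nat.cast_nonneg _
  have n3 : (0 : ℝ) ≤ D y := Nat.cast_nonneg _
  have n4 : (0 : ℝ) ≤ D₁ y := Nat.cast_nonneg _
  have n5 : (0 : ℝ) ≤ offCount σ₁ σ₂ y := Nat.cast_nonneg _
  have n6 : (0 : ℝ) ≤ (N : ℝ) ^ (2 / 3 : ℝ) := Real.rpow_nonneg (Nat.cast_nonneg _) _
  have g1 : 0 ≤ dilGain y + shGain u₁ y := add_nonneg (dilGain_nonneg y) (shGain_nonneg _ y)
  have g2 : 0 ≤ dilGain y + shGain u₂ y := add_nonneg (dilGain_nonneg y) (shGain_nonneg _ y)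
  rcases le_total (shGain u₁ y) (shGain u₂ y) with hle | hle
  · exact ⟨u₂, hu₂, gluedW_core H₁ H₂ hRc hDc n1 n2 n3 n4 n5 n6 g1 g2 (by linarith) le_rfl hc₁ hc₂⟩
  · exact ⟨u₁, hu₁, gluedW_core H₁ H₂ hRc hDc n1 n2 n3 n4 n5 n6 g1 g2 le_rfl (by linarith) hc₁ hc₂⟩

/-! ### The named statements ARE `CensusW` of their counts (definitional bridges) -/

/-- `balancedFccBallGapW_iff_censusW` (docstring added by the landing lane; see the module docstring). [formal bookkeeping] -/
theorem balancedFccBallGapW_iff_censusW {ρ ε g r σ₁ σ₂ : ℝ} : BalancedFccBallGapW ρ ε g r σ₁ σ₂ ↔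
    CensusW (fun y => fccBallCount ρ ε g r y) (fun y => notDeepCount ρ ε g y) σ₁ σ₂ := Iff.rfl

/-- `balancedRigidFccBallGapW_iff_censusW` (docstring added by the landing lane; see the module docstring). [formal bookkeeping] -/
theorem balancedRigidFccBallGapW_iff_censusW {ρ ρ₁ ε₁ θ₀ s₁ ε g r σ₁ σ₂ : ℝ} : BalancedRigidFccBallGapW ρ ρ₁ ε₁ θ₀ s₁ ε g r σ₁ σ₂ ↔
    CensusW (fun y => rigidFccBallCount ρ ρ₁ ε₁ θ₀ s₁ ε g r y) (fun y => notDeepCount ρ ε g y) σ₁ σ₂ := Iff.rfl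

/-- `balancedCompressedFccBallGapW_iff_censusW` (docstring added by the landing lane; see the module docstring). [formal bookkeeping] -/
theorem balancedCompressedFccBallGapW_iff_censusW {ρ ρ₁ ε₁ θ₀ s₁ ε g r σ₁ σ₂ : ℝ} : BalancedCompressedFccBallGapW ρ ρ₁ ε₁ θ₀ s₁ ε g r σ₁ σ₂ ↔
    CensusW (fun y => compressedFccBallCount ρ ρ₁ ε₁ θ₀ s₁ ε g r y) (fun y => notDeepCount ρ ε g y) σ₁ σ₂ := Iff.rfl

/-- `balancedShearedFccBallGapW_iff_censusW` (docstring added by the landing lane; see the module docstring). [formal bookkeeping] -/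
theorem balancedShearedFccBallGapW_iff_censusW {ρ ρ₁ ε₁ θ₀ θ ε g r σ₁ σ₂ : ℝ} : BalancedShearedFccBallGapW ρ ρ₁ ε₁ θ₀ θ ε g r σ₁ σ₂ ↔
    CensusW (fun y => shearedFccBallCount ρ ρ₁ ε₁ θ₀ θ ε g r y) (fun y => notDeepCount ρ ε g y) σ₁ σ₂ := Iff.rfl

/-- `balancedFlexFccBallGapW_iff_censusW` (docstring added by the landing lane; see the module docstring). [formal bookkeeping] -/
theorem balancedFlexFccBallGapW_iff_censusW {ρ ρ₁ ε₁ θ₀ ε g r σ₁ σ₂ : ℝ} : BalancedFlexFccBallGapW ρ ρ₁ ε₁ θ₀ ε g r σ₁ σ₂ ↔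
    CensusW (fun y => fccRoughCount ρ ρ₁ ε₁ θ₀ ε g r y) (fun y => notDeepCount ρ ε g y) σ₁ σ₂ := Iff.rfl

/-- `balancedFccRoughGapW_iff_censusW` (docstring added by the landing lane; see the module docstring). [formal bookkeeping] -/
theorem balancedFccRoughGapW_iff_censusW {ρ ρ₁ ε₁ θ ε g r σ₁ σ₂ : ℝ} : BalancedFccRoughGapW ρ ρ₁ ε₁ θ ε g r σ₁ σ₂ ↔
    CensusW (fun y => fccRoughCount ρ ρ₁ ε₁ θ ε g r y) (fun y => notDeepCount ρ ε g y + mixedRoughCount ρ ρ₁ ε₁ θ ε g r y) σ₁ σ₂ := Iff.rfl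

/-- `balancedMixedRoughGapW_iff_censusW` (docstring added by the landing lane; see the module docstring). [formal bookkeeping] -/
theorem balancedMixedRoughGapW_iff_censusW {ρ ρ₁ ε₁ θ ε g r σ₁ σ₂ : ℝ} : BalancedMixedRoughGapW ρ ρ₁ ε₁ θ ε g r σ₁ σ₂ ↔
    CensusW (fun y => mixedRoughCount ρ ρ₁ ε₁ θ ε g r y) (fun y => notDeepCount ρ ε g y) σ₁ σ₂ := Iff.rfl

/-- `balancedInterfaceCubicGapW_iff_censusW` (docstring added by the landing lane; see the module docstring). [formal bookkeeping] -/
theorem balancedInterfaceCubicGapW_iff_censusW {ρ ε g r σ₁ σ₂ : ℝ} : BalancedInterfaceCubicGapW ρ ε g r σ₁ σ₂ ↔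
    CensusW (fun y => interfaceCubicCount ρ ε g r y) (fun y => notDeepCount ρ ε g y) σ₁ σ₂ := Iff.rfl

/-! ## §4  THE SEAMS (PROVED): KF ⇒ KR, KO, KX; KX ⇒ KS, QC; KR ∧ KO ∧ KX ⇒ KF; KS ∧ QC ∧ PM ⇒ KX; and the COMPETITOR SEAM TG ∧ KO ∧ KX ∧ HI ⇒ KF -/

/-- **KF_W ⇒ KR_W** (subset priced, same rebate). [this file] -/
theorem balancedRigidFccBallGapW_of_fccBallGapW {ρ ρ₁ ε₁ θ₀ s₁ ε g r σ₁ σ₂ : ℝ} (h : BalancedFccBallGapW ρ ε g r σ₁ σ₂) :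
    BalancedRigidFccBallGapW ρ ρ₁ ε₁ θ₀ s₁ ε g r σ₁ σ₂ :=
  balancedRigidFccBallGapW_iff_censusW.2 <|
    censusW_mono (fun y => rigidFccBallCount_le_fccBallCount y) (fun _ => le_rfl) (balancedFccBallGapW_iff_censusW.1 h)

/-- **KF_W ⇒ KO_W**. [this file] -/
theorem balancedCompressedFccBallGapW_of_fccBallGapW {ρ ρ₁ ε₁ θ₀ s₁ ε g r σ₁ σ₂ : ℝ} (h : BalancedFccBallGapW ρ ε g r σ₁ σ₂) :
    BalancedCompressedFccBallGapW ρ ρ₁ ε₁ θ₀ s₁ ε g r σ₁ σ₂ :=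
  balancedCompressedFccBallGapW_iff_censusW.2 <|
    censusW_mono (fun y => compressedFccBallCount_le_fccBallCount y) (fun _ => le_rfl) (balancedFccBallGapW_iff_censusW.1 h)

/-- **KF_W ⇒ KX_W**. [this file] -/
theorem balancedFlexFccBallGapW_of_fccBallGapW {ρ ρ₁ ε₁ θ₀ ε g r σ₁ σ₂ : ℝ} (h : BalancedFccBallGapW ρ ε g r σ₁ σ₂) :
    BalancedFlexFccBallGapW ρ ρ₁ ε₁ θ₀ ε g r σ₁ σ₂ :=
  balancedFlexFccBallGapW_iff_censusW.2 <|
    censusW_mono (fun y => fccRoughCount_le_fccBallCount y) (fun _ => le_rfl) (balancedFccBallGapW_iff_censusW.1 h)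

/-- **KX_W(θ₀) ⇒ KS_W(θ₀, θ)** (subset priced). [this file] -/
theorem balancedShearedFccBallGapW_of_flexW {ρ ρ₁ ε₁ θ₀ θ ε g r σ₁ σ₂ : ℝ} (h : BalancedFlexFccBallGapW ρ ρ₁ ε₁ θ₀ ε g r σ₁ σ₂) :
    BalancedShearedFccBallGapW ρ ρ₁ ε₁ θ₀ θ ε g r σ₁ σ₂ :=
  balancedShearedFccBallGapW_iff_censusW.2 <|
    censusW_mono (fun y => shearedFccBallCount_le_fccRoughCount y) (fun _ => le_rfl) (balancedFlexFccBallGapW_iff_censusW.1 h)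

/-- **KX_W(θ₀) ⇒ QC_W(θ)** for `θ₀ ≤ θ` (subset priced by `θ`-monotonicity, superset rebated). [this file] -/
theorem balancedFccRoughGapW_of_flexW {ρ ρ₁ ε₁ θ₀ θ ε g r σ₁ σ₂ : ℝ} (hθ : θ₀ ≤ θ) (h : BalancedFlexFccBallGapW ρ ρ₁ ε₁ θ₀ ε g r σ₁ σ₂) :
    BalancedFccRoughGapW ρ ρ₁ ε₁ θ ε g r σ₁ σ₂ :=
  balancedFccRoughGapW_iff_censusW.2 <|
    censusW_mono (fun y => fccRoughCount_anti_theta hθ y) (fun _ => Nat.le_add_right _ _) (balancedFlexFccBallGapW_iff_censusW.1 h)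

/-- **KS_W ∧ QC_W ∧ PM_W ⇒ KX_W** (`θ₀ ≤ θ` not even needed: excluded middle on `AffDeepReg … θ`, the QC rebate `#mixedRough(θ)` bought back from PM). [this file] -/
theorem balancedFlexFccBallGapW_of_sheared_rough_mixed {ρ ρ₁ ε₁ θ₀ θ ε g r σ₁ σ₂ : ℝ}
    (hS : BalancedShearedFccBallGapW ρ ρ₁ ε₁ θ₀ θ ε g r σ₁ σ₂) (hQ : BalancedFccRoughGapW ρ ρ₁ ε₁ θ ε g r σ₁ σ₂)
    (hM : BalancedMixedRoughGapW ρ ρ₁ ε₁ θ ε g r σ₁ σ₂) : BalancedFlexFccBallGapW ρ ρ₁ ε₁ θ₀ ε g r σ₁ σ₂ := by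
  -- QC with its two-letter-ball rebate bought back: `fccRough(θ)` priced against `#¬deep` alone
  have hQ' : CensusW (fun y => fccRoughCount ρ ρ₁ ε₁ θ ε g r y) (fun y => notDeepCount ρ ε g y) σ₁ σ₂ :=
    censusW_glue (R := fun y => fccRoughCount ρ ρ₁ ε₁ θ ε g r y) (fun _ => Nat.le_add_right _ _) (fun _ => le_rfl)
      (balancedFccRoughGapW_iff_censusW.1 hQ) (balancedMixedRoughGapW_iff_censusW.1 hM)
  exact balancedFlexFccBallGapW_iff_censusW.2 <|
    censusW_glue (fun y => fccRoughCount_le_sheared_add_fccRough y) (fun _ => Nat.le_add_right _ _)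
      (balancedShearedFccBallGapW_iff_censusW.1 hS) hQ'

/-- **KR_W ∧ KO_W ∧ KX_W ⇒ KF_W** (excluded middle on the mechanical state, glued twice). [this file] -/
theorem balancedFccBallGapW_of_rigid_compressed_flex {ρ ρ₁ ε₁ θ₀ s₁ ε g r σ₁ σ₂ : ℝ}
    (hR : BalancedRigidFccBallGapW ρ ρ₁ ε₁ θ₀ s₁ ε g r σ₁ σ₂) (hO : BalancedCompressedFccBallGapW ρ ρ₁ ε₁ θ₀ s₁ ε g r σ₁ σ₂)
    (hX : BalancedFlexFccBallGapW ρ ρ₁ ε₁ θ₀ ε g r σ₁ σ₂) : BalancedFccBallGapW ρ ε g r σ₁ σ₂ := by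
  have hOX : CensusW (fun y => compressedFccBallCount ρ ρ₁ ε₁ θ₀ s₁ ε g r y + fccRoughCount ρ ρ₁ ε₁ θ₀ ε g r y)
      (fun y => notDeepCount ρ ε g y) σ₁ σ₂ :=
    censusW_glue (fun _ => le_rfl) (fun _ => Nat.le_add_right _ _)
      (balancedCompressedFccBallGapW_iff_censusW.1 hO) (balancedFlexFccBallGapW_iff_censusW.1 hX)
  exact balancedFccBallGapW_iff_censusW.2 <|
    censusW_glue (fun y => (fccBallCount_le_rigid_add_compressed_add_fccRough y).trans (Nat.add_assoc _ _ _).le)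
      (fun _ => Nat.le_add_right _ _) (balancedRigidFccBallGapW_iff_censusW.1 hR) hOX

/-- **THE COMPETITOR SEAM: TG_W ∧ KO_W ∧ KX_W ∧ HI_W ⇒ KF_W.**  The free bulk floor `N e⋆ ≤ 𝓔(y′)` (`floor_le`) is spent on the COMPETITOR, turning
TG into a census inequality for `#rigid` whose rebate exceeds `#¬deep` by the exchange currency `#compressed + #flex + #interfaceCubic`; that currency
is priced by `KO ∧ KX ∧ HI` (census glue twice); one glued convex combination buys it back (`gluedW_core` with `D₁ = D + B`). [this file] -/
theorem balancedFccBallGapW_of_twinGainW {ρ ρ₁ ε₁ θ₀ s₁ ε g r σ₁ σ₂ : ℝ}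
    (hT : TwinGainW ρ ρ₁ ε₁ θ₀ s₁ ε g r σ₁ σ₂) (hO : BalancedCompressedFccBallGapW ρ ρ₁ ε₁ θ₀ s₁ ε g r σ₁ σ₂)
    (hX : BalancedFlexFccBallGapW ρ ρ₁ ε₁ θ₀ ε g r σ₁ σ₂) (hI : BalancedInterfaceCubicGapW ρ ε g r σ₁ σ₂) :
    BalancedFccBallGapW ρ ε g r σ₁ σ₂ := by
  -- the exchange partner: `#compressed + #flex + #interfaceCubic` priced against `#¬deep`
  have hOX : CensusW (fun y => compressedFccBallCount ρ ρ₁ ε₁ θ₀ s₁ ε g r y + fccRoughCount ρ ρ₁ ε₁ θ₀ ε g r y)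
      (fun y => notDeepCount ρ ε g y) σ₁ σ₂ :=
    censusW_glue (fun _ => le_rfl) (fun _ => Nat.le_add_right _ _)
      (balancedCompressedFccBallGapW_iff_censusW.1 hO) (balancedFlexFccBallGapW_iff_censusW.1 hX)
  have hP : CensusW
      (fun y => compressedFccBallCount ρ ρ₁ ε₁ θ₀ s₁ ε g r y + fccRoughCount ρ ρ₁ ε₁ θ₀ ε g r y + interfaceCubicCount ρ ε g r y)
      (fun y => notDeepCount ρ ε g y) σ₁ σ₂ :=
    censusW_glue (fun _ => le_rfl) (fun _ => Nat.le_add_right _ _) hOX (balancedInterfaceCubicGapW_iff_censusW.1 hI)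
  obtain ⟨c₁, C₁, hc₁, h₁⟩ := hT
  obtain ⟨c₂, C₂, hc₂, h₂⟩ := hP
  refine ⟨glueRate c₁ C₁ c₂, max C₁ 0 + max C₂ 0, glueRate_pos hc₁ hc₂, fun N y hy => ?_⟩
  obtain ⟨y', hy', -, H₁⟩ := h₁ N y hy
  obtain ⟨u, hu, H₂⟩ := h₂ N y hy
  refine ⟨u, hu, ?_⟩
  beta_reduce at H₂
  have hfl := floor_le hy'
  have nA : (0 : ℝ) ≤ rigidFccBallCount ρ ρ₁ ε₁ θ₀ s₁ ε g r y := Nat.cast_nonneg _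
  have nX : (0 : ℝ) ≤ ((compressedFccBallCount ρ ρ₁ ε₁ θ₀ s₁ ε g r y + fccRoughCount ρ ρ₁ ε₁ θ₀ ε g r y
      + interfaceCubicCount ρ ε g r y : ℕ) : ℝ) := Nat.cast_nonneg _
  have nD : (0 : ℝ) ≤ notDeepCount ρ ε g y := Nat.cast_nonneg _
  have nO : (0 : ℝ) ≤ offCount σ₁ σ₂ y := Nat.cast_nonneg _
  have nS : (0 : ℝ) ≤ (N : ℝ) ^ (2 / 3 : ℝ) := Real.rpow_nonneg (Nat.cast_nonneg _) _
  have g2 : 0 ≤ dilGain y + shGain u y := add_nonneg (dilGain_nonneg y) (shGain_nonneg _ y)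
  -- TG with the bulk floor spent on the competitor, in census shape with the enlarged rebate `#¬deep + X` and no gain term
  have H₁' : (N : ℝ) * (⨅ Q : PeriodicConfiguration 3, Q.energyPerParticle lennardJones)
      + c₁ * (rigidFccBallCount ρ ρ₁ ε₁ θ₀ s₁ ε g r y : ℝ)
      - C₁ * ((notDeepCount ρ ε g y : ℝ) + ((compressedFccBallCount ρ ρ₁ ε₁ θ₀ s₁ ε g r y + fccRoughCount ρ ρ₁ ε₁ θ₀ ε g r y
          + interfaceCubicCount ρ ε g r y : ℕ) : ℝ))
      - C₁ * (offCount σ₁ σ₂ y : ℝ) - C₁ * (N : ℝ) ^ (2 / 3 : ℝ) - C₁ * 0 ≤ interactionEnergy lennardJones y := by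
    linarith
  have hRc : (fccBallCount ρ ε g r y : ℝ) ≤ rigidFccBallCount ρ ρ₁ ε₁ θ₀ s₁ ε g r y
      + ((compressedFccBallCount ρ ρ₁ ε₁ θ₀ s₁ ε g r y + fccRoughCount ρ ρ₁ ε₁ θ₀ ε g r y + interfaceCubicCount ρ ε g r y : ℕ) : ℝ) := by
    have h := fccBallCount_le_rigid_add_compressed_add_fccRough (ρ₁ := ρ₁) (ε₁ := ε₁) (θ₀ := θ₀) (s₁ := s₁) (ρ := ρ) (ε := ε) (g := g) (r := r) y
    have h' : ((fccBallCount ρ ε g r y : ℕ) : ℝ) ≤ ((rigidFccBallCount ρ ρ₁ ε₁ θ₀ s₁ ε g r y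
        + compressedFccBallCount ρ ρ₁ ε₁ θ₀ s₁ ε g r y + fccRoughCount ρ ρ₁ ε₁ θ₀ ε g r y : ℕ) : ℝ) := by exact_mod_cast h
    have nI : (0 : ℝ) ≤ interfaceCubicCount ρ ε g r y := Nat.cast_nonneg _
    push_cast at h' ⊢
    linarith
  exact gluedW_core H₁' H₂ hRc le_rfl nA nX nD (add_nonneg nD nX) nO nS le_rfl g2 g2 le_rfl hc₁ hc₂

/-! ### Tame forms and the frame of record -/

/-- KF ⇒ KR (tame). -/
theorem tameBalancedRigidFccBallGap_of_fccBallGap {ρ ρ₁ ε₁ θ₀ s₁ ε g r : ℝ} (h : TameBalancedFccBallGap ρ ε g r) :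
    TameBalancedRigidFccBallGap ρ ρ₁ ε₁ θ₀ s₁ ε g r :=
  fun δ hδ hδ2 => balancedRigidFccBallGapW_of_fccBallGapW (h δ hδ hδ2)

/-- KF ⇒ KO (tame). -/
theorem tameBalancedCompressedFccBallGap_of_fccBallGap {ρ ρ₁ ε₁ θ₀ s₁ ε g r : ℝ} (h : TameBalancedFccBallGap ρ ε g r) :
    TameBalancedCompressedFccBallGap ρ ρ₁ ε₁ θ₀ s₁ ε g r :=
  fun δ hδ hδ2 => balancedCompressedFccBallGapW_of_fccBallGapW (h δ hδ hδ2)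

/-- KF ⇒ KX (tame). -/
theorem tameBalancedFlexFccBallGap_of_fccBallGap {ρ ρ₁ ε₁ θ₀ ε g r : ℝ} (h : TameBalancedFccBallGap ρ ε g r) :
    TameBalancedFlexFccBallGap ρ ρ₁ ε₁ θ₀ ε g r :=
  fun δ hδ hδ2 => balancedFlexFccBallGapW_of_fccBallGapW (h δ hδ hδ2)

/-- KR ∧ KO ∧ KX ⇒ KF (tame). -/
theorem tameBalancedFccBallGap_of_rigid_compressed_flex {ρ ρ₁ ε₁ θ₀ s₁ ε g r : ℝ} (hR : TameBalancedRigidFccBallGap ρ ρ₁ ε₁ θ₀ s₁ ε g r)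
    (hO : TameBalancedCompressedFccBallGap ρ ρ₁ ε₁ θ₀ s₁ ε g r) (hX : TameBalancedFlexFccBallGap ρ ρ₁ ε₁ θ₀ ε g r) :
    TameBalancedFccBallGap ρ ε g r :=
  fun δ hδ hδ2 => balancedFccBallGapW_of_rigid_compressed_flex (hR δ hδ hδ2) (hO δ hδ hδ2) (hX δ hδ hδ2)

/-- TG ∧ KO ∧ KX ∧ HI ⇒ KF (tame). -/
theorem tameBalancedFccBallGap_of_twinGain {ρ ρ₁ ε₁ θ₀ s₁ ε g r : ℝ} (hT : TameTwinGain ρ ρ₁ ε₁ θ₀ s₁ ε g r)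
    (hO : TameBalancedCompressedFccBallGap ρ ρ₁ ε₁ θ₀ s₁ ε g r) (hX : TameBalancedFlexFccBallGap ρ ρ₁ ε₁ θ₀ ε g r)
    (hI : TameBalancedInterfaceCubicGap ρ ε g r) : TameBalancedFccBallGap ρ ε g r :=
  fun δ hδ hδ2 => balancedFccBallGapW_of_twinGainW (hT δ hδ hδ2) (hO δ hδ hδ2) (hX δ hδ hδ2) (hI δ hδ hδ2)

/-- `CubicCushion ⇒ RigidCubicCushion`. [this file] -/
theorem rigidCubicCushion_of_cubicCushion (h : CubicCushion) : RigidCubicCushion :=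
  tameBalancedRigidFccBallGap_of_fccBallGap h

/-- `CubicCushion ⇒ CompressedCubic`. [this file] -/
theorem compressedCubic_of_cubicCushion (h : CubicCushion) : CompressedCubic :=
  tameBalancedCompressedFccBallGap_of_fccBallGap h

/-- `CubicCushion ⇒ FlexCubic`. [this file] -/
theorem flexCubic_of_cubicCushion (h : CubicCushion) : FlexCubic :=
  tameBalancedFlexFccBallGap_of_fccBallGap h

/-- `FlexCubic ⇒ ShearedCubic`. [this file] -/
theorem shearedCubic_of_flexCubic (h : FlexCubic) : ShearedCubic :=
  fun δ hδ hδ2 => balancedShearedFccBallGapW_of_flexW (h δ hδ hδ2)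

/-- `FlexCubic ⇒ RoughCubic` (`1/1000 ≤ 1/25`). [this file] -/
theorem roughCubic_of_flexCubic (h : FlexCubic) : RoughCubic :=
  fun δ hδ hδ2 => balancedFccRoughGapW_of_flexW (by norm_num) (h δ hδ hδ2)

/-- `CubicCushion ⇒ ShearedCubic` and `CubicCushion ⇒ RoughCubic` (the latter is g76's `fccRough_record_of_cubicCushion`). [this file] -/
theorem shearedCubic_of_cubicCushion (h : CubicCushion) : ShearedCubic :=
  shearedCubic_of_flexCubic (flexCubic_of_cubicCushion h)

/-- `roughCubic_of_cubicCushion` (docstring added by the landing lane; see the module docstring). [formal bookkeeping] -/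
theorem roughCubic_of_cubicCushion (h : CubicCushion) : RoughCubic :=
  fccRough_record_of_cubicCushion h

/-- **`RigidCubicCushion ∧ CompressedCubic ∧ FlexCubic ⇒ CubicCushion`**. [this file] -/
theorem cubicCushion_of_mechanicalStates (hR : RigidCubicCushion) (hO : CompressedCubic) (hX : FlexCubic) : CubicCushion :=
  tameBalancedFccBallGap_of_rigid_compressed_flex hR hO hX

/-- **THE LOSSLESS SPLIT OF KF BY MECHANICAL STATE (the node's EQUIV)**: `CubicCushion ↔ RigidCubicCushion ∧ CompressedCubic ∧ FlexCubic`. [this file] -/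
theorem cubicCushion_iff_mechanicalStates : CubicCushion ↔ RigidCubicCushion ∧ CompressedCubic ∧ FlexCubic :=
  ⟨fun h => ⟨rigidCubicCushion_of_cubicCushion h, compressedCubic_of_cubicCushion h, flexCubic_of_cubicCushion h⟩,
    fun h => cubicCushion_of_mechanicalStates h.1 h.2.1 h.2.2⟩

/-- **`ShearedCubic ∧ RoughCubic ∧ PM ⇒ FlexCubic`** (PM of record supplies QC's two-letter-ball rebate). [this file] -/
theorem flexCubic_of_sheared_rough_mixed (hS : ShearedCubic) (hQ : RoughCubic)
    (hM : TameBalancedMixedRoughGap 64 12 (1 / 10 ^ 5) (1 / 25) (3 / 50) (1 / 450) 12) : FlexCubic :=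
  fun δ hδ hδ2 => balancedFlexFccBallGapW_of_sheared_rough_mixed (hS δ hδ hδ2) (hQ δ hδ hδ2) (hM δ hδ hδ2)

/-- `ShearedCubic ∧ RoughCubic ∧ InterfaceDominance ⇒ FlexCubic` (PM from HI, g76's `mixedRough_record_of_interfaceDominance`). [this file] -/
theorem flexCubic_of_sheared_rough_interface (hS : ShearedCubic) (hQ : RoughCubic) (hI : InterfaceDominance) : FlexCubic :=
  flexCubic_of_sheared_rough_mixed hS hQ (mixedRough_record_of_interfaceDominance hI)

/-- **`TwinGain ∧ CompressedCubic ∧ FlexCubic ∧ InterfaceDominance ⇒ CubicCushion`** (the competitor seam at the record). [this file] -/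
theorem cubicCushion_of_twinGain (hT : TwinGain) (hO : CompressedCubic) (hX : FlexCubic) (hI : InterfaceDominance) : CubicCushion :=
  tameBalancedFccBallGap_of_twinGain hT hO hX hI

/-- **THE CUT OF THE TRANSFER TARGET'S CUBIC HALF**: `TwinGain ∧ CompressedCubic ∧ ShearedCubic ∧ RoughCubic ∧ InterfaceDominance ⇒ CubicCushion`. [this file] -/
theorem cubicCushion_of_twinCut (hT : TwinGain) (hO : CompressedCubic) (hS : ShearedCubic) (hQ : RoughCubic) (hI : InterfaceDominance) :
    CubicCushion :=
  cubicCushion_of_twinGain hT hO (flexCubic_of_sheared_rough_interface hS hQ hI) hI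

/-- `TwinGain ∧ CompressedCubic ∧ ShearedCubic ∧ RoughCubic ∧ InterfaceDominance ⇒ RigidCubicCushion` (TG is stronger than KR modulo the partners). -/
theorem rigidCubicCushion_of_twinCut (hT : TwinGain) (hO : CompressedCubic) (hS : ShearedCubic) (hQ : RoughCubic) (hI : InterfaceDominance) :
    RigidCubicCushion :=
  rigidCubicCushion_of_cubicCushion (cubicCushion_of_twinCut hT hO hS hQ hI)

/-- **`… ⇒ HexagonalDominance`**: the transfer target from the TwinCut leaves (g76's `hexagonalDominance_of_cubicCushion_interfaceDominance`). [this file] -/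
theorem hexagonalDominance_of_twinCut (hT : TwinGain) (hO : CompressedCubic) (hS : ShearedCubic) (hQ : RoughCubic) (hI : InterfaceDominance) :
    HexagonalDominance :=
  hexagonalDominance_of_cubicCushion_interfaceDominance (cubicCushion_of_twinCut hT hO hS hQ hI) hI

/-- **THE REFINED LOSSLESS SPLIT OF THE TRANSFER TARGET**: `HexagonalDominance ↔ RigidCubicCushion ∧ CompressedCubic ∧ ShearedCubic ∧ RoughCubic ∧
InterfaceDominance` (g76's `HD ↔ KF ∧ HI` with KF split by mechanical state and KX split by distortion, PM from HI). [this file] -/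
theorem hexagonalDominance_iff_fiveLeaves :
    HexagonalDominance ↔ RigidCubicCushion ∧ CompressedCubic ∧ ShearedCubic ∧ RoughCubic ∧ InterfaceDominance := by
  constructor
  · intro h
    have hF := cubicCushion_of_hexagonalDominance h
    exact ⟨rigidCubicCushion_of_cubicCushion hF, compressedCubic_of_cubicCushion hF, shearedCubic_of_cubicCushion hF,
      roughCubic_of_cubicCushion hF, interfaceDominance_of_hexagonalDominance h⟩
  · rintro ⟨hR, hO, hS, hQ, hI⟩
    exact hexagonalDominance_of_cubicCushion_interfaceDominance
      (cubicCushion_of_mechanicalStates hR hO (flexCubic_of_sheared_rough_interface hS hQ hI)) hI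

end Summit.AtomisticToContinuum.Crystallization.Theorems.OverbindingBudgetAffineTwinCut
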